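import Literature.AnabelianGeometry.EtaleTheta.Discharge.Sec3Cor38iAssembly
import Literature.AnabelianGeometry.EtaleTheta.Discharge.Sec3Cor38iiiOfIsFrobenioidWeak
import Literature.AnabelianGeometry.EtaleTheta.Discharge.Sec3Cor38CriterionCoordWeak
import Literature.AnabelianGeometry.EtaleTheta.Discharge.Sec3RatFnMonoidOn
import Literature.AnabelianGeometry.EtaleTheta.TemperedFrobenioidCnst
import Literature.AlgebraicGeometry.Frobenioids.EquivalencePreStepsFSMFF2008Assembly
import HarnessLib

/-!
# [EtTh] Corollary 3.8 (i) AS TYPED over the WEAK canonical monoid vocabulary (tempered coverings with infinitely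
# many special-fibre components) — and, for every monoid vocabulary, the node closer with C38-L05 as a BINDER

S. Mochizuki, *The étale theta function and its Frobenioid-theoretic manifestations*, Publ. RIMS **45** (2009),
Cor. 3.8 (i), statement PDF p. 80, proof PDF p. 81 l. 13–32 [cite: MochizukiEtTh2009, Cor 3.8 p.81]; Prop. 3.4
(i)/(ii) p. 74, Def. 3.6 (i)/(ii) pp. 76–77, Rmk. 3.6.4 p. 79; S. Mochizuki, *The geometry of Frobenioids I*,
Kyushu J. Math. **62** (2008), Thm. 3.4 (ii)–(iv) pp. 62–63 [cite: MochizukiFrdI2008, Thm. 3.4 (ii) p.62],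
Def. 2.4 (i) pp. 47–48.

abc-iut cell, layer L2, cone node `EtTh:Cor3.8(i)` (kernel id `N_EtTh_Cor3_8_i`), seat abc-iut-w6-d039 (gen 3);
PROOF-ONLY sequel (0 definitions) of this lineage's `Discharge/Sec3Cor38iAssembly.lean` (p430168) and
`Discharge/Sec3Cor38iOfRatSupport.lean` (p438712).

WHY.  Cell finding F-L2d2-1 (abc-iut-L2-d2, `FrdIVocabularyWeak.lean`): at a connected tempered covering whose
`Δ^fil`-closures have INFINITELY MANY special-fibre components (`Ÿ`, `Z_∞` — the objects [EtTh] §§4–5 work at),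
`Φ₀(Y^log) ⊇ ∏_j ℤ_{≥0}` is NOT perf-factorial as printed ([FrdI] Def. 2.4 (i)(d) fails), so Prop. 3.4 (i) / Def. 3.6
(ii) "perf-factorial" must be READ there with the weak notion `IsPerfFactorialCof` — the vocabulary
`treeMonoidVocabWeak`.  Every (i)-closer in the tree so far (this lineage's `cor38_i_of_thm34ii` /
`cor38_i_of_isOfStandardType` / `cor38_i_treeVocab*` / `cor38_i_of_ratSupport` …; abc-iut-f-034's
`cor38_i_of_criterion`) either lives at the STRONG vocabulary `treeMonoidVocab` or builds row C38-L05 in from the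
strong-vocabulary producer `bsFldPreStepLimitCriterion_of_line`.  abc-iut-w4-d084 proved row C38-L05 at the weak
vocabulary (`bsFldPreStepLimitCriterion_of_coordWeak`, p431193) and abc-iut-L2-d2 proved row C38-L01 there with no
residual (`Cor38Hyp.standardIsotropicNotGroupLike_treeMonoidVocabWeak`); the node-level (i)-closer at the weak
vocabulary was missing.  THIS FILE supplies it.

§1 (ANY monoid vocabulary `V`, ANY category vocabularies — the node closer with the criteria as binders, i.e. the
shape abc-iut-w6-d040 asked for on STATUS 10:34:38Z, "strictly more general"):
* `Cor38Hyp.preservesBsFldPreSteps_of_thm34ii_of_criteria` — C38-L06 for Frobenius-slim `D₁`, `D₂`: the criteria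
  `hc_i : C_i.BsFldPreStepLimitCriterion (PreFrobenioidData.perfection hF_i)` (row C38-L05, now BINDERS)
  transported (abc-iut-w5-d124's `preservesBsFldPreSteps_of_criterion`) along the equivalence of perfections
  `Ψ^pf = (Perfection.map hΨ).asEquivalence`, which `1`-commutes with `C_i → C_i^pf` and preserves co-angular
  pre-steps and `O^▷(−)` of the perfections by [FrdI] Thm. 3.4 (ii) (`h34`, named) and (iv) (its tree
  consequence `FrdI.thm34iv_ofFunctor_of_thm34ii`) applied to `Ψ^pf`, `(Ψ^pf)⁻¹` — this lineage's p430168 proof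
  with the two `_of_line` lines replaced by the binders;
* `Cor38Hyp.cor38_i_of_thm34ii_of_criteria` — the typed `Cor38_i` from `h34`, `hF_i` ([FrdI] Thm. 5.2 (ii)),
  `hstd_i` ([EtTh] Thm. 3.7 (ii)) and `hc_i` ONLY (rows L07, L07b, L07c discharged as in p430168).
§2 (WEAK canonical monoid vocabulary `treeMonoidVocabWeak`, ANY category vocabularies):
* `Cor38Hyp.cor38_i_weak_of_criteria` — `hstd_i` DROP OUT (C38-L01 unconditional at the weak vocabulary) and
  `h34 := FrdI.Thm34ii_holds` (F-0711 PROVED): inputs `hF_i`, `hc_i`;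
* `Cor38Hyp.cor38_i_weak_of_coord` — the criteria consumed from abc-iut-w4-d084's
  `bsFldPreStepLimitCriterion_of_coordWeak`: inputs `hF_i` and, per side, the print-level clauses `hP34Λ_i`
  (Prop. 3.4 (ii) at monoid type `Λ`, the typed field `Prop34Cnst.mem_FΛ_of_divΛ_eq_of`), `hNZ_i` (Def. 3.6
  (ii)(b)), `hQ_i` (every localized perfection `Φ_i(W)^pf_𝔮` is `ℚ`-monoprime — [FrdI] §0 / [EtTh] Rmk. 3.3.1
  for monoids of effective `ℤ`-divisors; cell GAP-LEDGER G-w4d084-3); `…_weak_of_coord_of_prop34Cnst` (`hP34Λ_i`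
  ⟸ the typed structure `T_i.Prop34Cnst cnst_i`).
§3 (weak monoid vocabulary, canonical category vocabulary `treeCatVocab`):
* `Cor38Hyp.cor38_i_weak_canonical_of_coord` — `hF_i` ⟸ abc-iut-L2's standing residual `hBmon_i` ([FrdI]
  Thm. 5.2 (ii), `isFrobenioid_treeCatVocab_of_isMonoidOn`);
* `Cor38Hyp.cor38_i_weak_canonical_of_structural` — `hBmon_i` ⟸ (`hBinj_i`, `hFSM_i`) through abc-iut-L2-t3's
  `isFrobenioid_of_structural`, `hP34Λ_i` ⟸ `T_i.Prop34Cnst cnst_i`: every input a named print-level clause.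

Nothing of L1 / abc-iut-L2-d2 / w4-d084 / w5-d124 / f-132 is re-derived; no statement of print is strengthened
(`hNZ`, `hQ` are print's standing situation for the geometric data and NOT derivable from the typed interfaces —
kernel certificates `ToyHNZ` p427694, `Sec3Cor38CriterionToy` p425444, `Sec3Cor38iStatementToy` p432851).
HONEST FRAMING: refereed pre-IUT material ([EtTh] §3 over [FrdI] §§3–5); nothing here bears on [IUTchIII]
Cor. 3.12; no side taken; typed ≠ proved — here proved modulo the displayed named binders.
-/

namespace Literature.AnabelianGeometry.EtaleTheta

open CategoryTheory Opposite Function Literature.AlgebraicGeometry.Frobenioids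

universe u₀ v₀ u v w u₁ v₁

/-! ## §1 Any monoid vocabulary: C38-L06 and Cor. 3.8 (i) with the criteria C38-L05 as binders -/

section AnyVocab

variable {D₀ : Type u₀} [Category.{v₀} D₀] {V : FrdIMonoidStub.{w}}
  {T : RealifiedDivisorMonoids (D₀ := D₀) V} {D : Type u} [Category.{v} D] {VD : FrdICatStub.{u, v, w} D}
  {D₀' : Type u₀} [Category.{v₀} D₀'] {T' : RealifiedDivisorMonoids (D₀ := D₀') V}
  {D' : Type u} [Category.{v} D'] {VD' : FrdICatStub.{u, v, w} D'}
  {C₁ : TemperedFrobenioid T D VD} {C₂ : TemperedFrobenioid T' D' VD'} (h : Cor38Hyp C₁ C₂)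

open TemperedFrobenioid

/-- **C38-L06 for Frobenius-slim bases, over ANY monoid vocabulary, the criteria C38-L05 as BINDERS** ("Thus, `Ψ`
preserves the base-field-theoretic pre-steps", p.81 l.27–28): given [FrdI] Thm. 3.4 (ii) by name (`h34`), `hF_i`
([FrdI] Thm. 5.2 (ii)), `hstd_i` ([EtTh] Thm. 3.7 (ii)) and the base-field-theoretic pre-step criteria `hc_i` at THE
perfections, `Ψ` and `Ψ⁻¹` preserve base-field-theoretic pre-steps — the criteria transported along
`Ψ^pf = (Perfection.map hΨ).asEquivalence` (`1`-commuting with `C_i → C_i^pf` by `toPfCompMapIso`), which preserves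
co-angular pre-steps and `O^▷(−)` of the perfections by [FrdI] Thm. 3.4 (ii), (iv) applied to `Ψ^pf`, `(Ψ^pf)⁻¹`
(the `C_i^pf` are Frobenioids of standard type over the same Frobenius-slim bases, not of group-like type —
Rmk. 3.6.4).  This lineage's `preservesBsFldPreSteps_of_thm34ii` (p430168) with its two `_of_line` producers
replaced by the binders `hc₁`, `hc₂`. [cite: MochizukiEtTh2009, Cor 3.8 p.81] -/
theorem Cor38Hyp.preservesBsFldPreSteps_of_thm34ii_of_criteria
    (h34 : Literature.AlgebraicGeometry.Frobenioids.FrdI.Thm34ii.{w, v, max v w, u, max u w})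
    (hF₁ : PreFrobenioid.IsFrobenioid C₁.toElem)
    (hF₂ : PreFrobenioid.IsFrobenioid C₂.toElem) (hstd₁ : C₁.opsData.IsOfStandardType)
    (hstd₂ : C₂.opsData.IsOfStandardType)
    (hc₁ : C₁.BsFldPreStepLimitCriterion (PreFrobenioidData.perfection hF₁))
    (hc₂ : C₂.BsFldPreStepLimitCriterion (PreFrobenioidData.perfection hF₂))
    (hFs : IsFrobeniusSlim D) (hFs' : IsFrobeniusSlim D') : h.PreservesBsFldPreSteps := by
  -- [FrdI] Thm. 3.4 (ii) for `Ψ`, `Ψ⁻¹` (named fact `h34`) ⟹ C38-L02a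
  have hps : h.PreservesPreSteps :=
    h.preservesPreSteps_of_thm34ii (h34 _ _ hF₁ hF₂ h.Ψ) (h34 _ _ hF₂ hF₁ h.Ψ.symm)
      (C₁.opsData_isOfQuasiIsotropicType hF₁) (C₂.opsData_isOfQuasiIsotropicType hF₂)
  -- C38-L03, constructively: `Ψ^pf` and its square
  have hΨ := h.isFrobeniusCompatible_of h34 hF₁ hF₂ hstd₁ hstd₂
  haveI := PreFrobenioid.Perfection.map_isEquivalence (hF₁ := hF₁) (hF₂ := hF₂) h.Ψ hΨ
  let G : (PreFrobenioidData.perfection hF₁).Pf ≌ (PreFrobenioidData.perfection hF₂).Pf :=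
    (PreFrobenioid.Perfection.map (hF₁ := hF₁) (hF₂ := hF₂) hΨ).asEquivalence
  have hcomm : OneCommutes h.Ψ.functor (PreFrobenioidData.perfection hF₂).toPf
      (PreFrobenioidData.perfection hF₁).toPf G.functor :=
    ⟨(PreFrobenioid.Perfection.toPfCompMapIso (hF₁ := hF₁) (hF₂ := hF₂) hΨ).symm⟩
  -- the perfections are Frobenioids of standard type, not of group-like type
  have hPf₁ := C₁.perfection_ops_isFrobenioid hF₁
  have hPf₂ := C₂.perfection_ops_isFrobenioid hF₂
  have hq₁ := C₁.perfection_ops_isOfQuasiIsotropicType hF₁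
  have hq₂ := C₂.perfection_ops_isOfQuasiIsotropicType hF₂
  have hs₁ := C₁.perfection_ops_isOfStandardType hF₁ hstd₁
  have hs₂ := C₂.perfection_ops_isOfStandardType hF₂ hstd₂
  have hB : PreFrobenioidData.HypB (PreFrobenioidData.perfection hF₁).ops
      (PreFrobenioidData.perfection hF₂).ops G :=
    hypB_of_not_isOfGroupLikeType _ _ _ (C₁.perfection_ops_not_isOfGroupLikeType hF₁)
  have hB' : PreFrobenioidData.HypB (PreFrobenioidData.perfection hF₂).ops
      (PreFrobenioidData.perfection hF₁).ops G.symm :=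
    hypB_of_not_isOfGroupLikeType _ _ _ (C₂.perfection_ops_not_isOfGroupLikeType hF₂)
  -- [FrdI] Thm. 3.4 (ii), (iv) for `Ψ^pf`, `(Ψ^pf)⁻¹`
  have g2 : (PreFrobenioidData.perfection hF₁).ops.Thm34ii (PreFrobenioidData.perfection hF₂).ops G :=
    h34 _ _ hPf₁ hPf₂ G
  have g2' : (PreFrobenioidData.perfection hF₂).ops.Thm34ii (PreFrobenioidData.perfection hF₁).ops G.symm :=
    h34 _ _ hPf₂ hPf₁ G.symm
  have g4 : (PreFrobenioidData.perfection hF₁).ops.Thm34iv (PreFrobenioidData.perfection hF₂).ops G :=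
    FrdI.thm34iv_ofFunctor_of_thm34ii hPf₁ hPf₂ G g2 g2'
  have g4' : (PreFrobenioidData.perfection hF₂).ops.Thm34iv (PreFrobenioidData.perfection hF₁).ops G.symm :=
    FrdI.thm34iv_ofFunctor_of_thm34ii hPf₂ hPf₁ G.symm g2' g2
  obtain ⟨-, hG, -⟩ := g2 hq₁ hq₂ h.fsmff.1 h.fsmff.2
  obtain ⟨-, hG', -⟩ := g2' hq₂ hq₁ h.fsmff.2 h.fsmff.1
  obtain ⟨hGe, -, -⟩ := g4 hs₁ hs₂ hB hFs hFs'
  obtain ⟨hGe', -, -⟩ := g4' hs₂ hs₁ hB' hFs' hFs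
  exact h.preservesBsFldPreSteps_of_criterion _ _ hps hc₁ hc₂ G hcomm hG hG' hGe hGe'

/-- **[EtTh] Cor. 3.8 (i) AS TYPED over ANY monoid vocabulary, the criteria C38-L05 as binders**: for tempered
Frobenioids `C₁`, `C₂` whose model categories are Frobenioids (`hF_i`, [FrdI] Thm. 5.2 (ii)) of standard type
(`hstd_i`, [EtTh] Thm. 3.7 (ii)), under `h : Cor38Hyp C₁ C₂` and GIVEN [FrdI] Thm. 3.4 (ii) by name (`h34`) and the
base-field-theoretic pre-step criteria `hc_i` at THE perfections (row C38-L05), `Ψ` preserves the base-field-theoretic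
morphisms whenever `D₁`, `D₂` are Frobenius-slim — rows L06 (`preservesBsFldPreSteps_of_thm34ii_of_criteria`), L07
(`preservesFactorisation_of_thm34` over Thm. 3.4 (iii) = `FrdI.thm34iii_ofFunctor_of_thm34ii`), L07b/L07c
(abc-iut-w5-d124, mod `hF`) assembled by `cor38_i_of_rows`.  Strictly more general than this lineage's
`cor38_i_of_thm34ii` (criterion built in at any vocabulary) and than abc-iut-f-034's `cor38_i_of_criterion`
(criteria as binders at the strong canonical monoid vocabulary). [cite: MochizukiEtTh2009, Cor 3.8 p.80] -/
theorem Cor38Hyp.cor38_i_of_thm34ii_of_criteria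
    (h34 : Literature.AlgebraicGeometry.Frobenioids.FrdI.Thm34ii.{w, v, max v w, u, max u w})
    (hF₁ : PreFrobenioid.IsFrobenioid C₁.toElem)
    (hF₂ : PreFrobenioid.IsFrobenioid C₂.toElem) (hstd₁ : C₁.opsData.IsOfStandardType)
    (hstd₂ : C₂.opsData.IsOfStandardType)
    (hc₁ : C₁.BsFldPreStepLimitCriterion (PreFrobenioidData.perfection hF₁))
    (hc₂ : C₂.BsFldPreStepLimitCriterion (PreFrobenioidData.perfection hF₂)) :
    Literature.AnabelianGeometry.EtaleTheta.Cor38_i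
      (fun E _ => Literature.AlgebraicGeometry.Frobenioids.IsFrobeniusSlim E) h := by
  have H := h.standardIsotropicNotGroupLike_of hstd₁ hstd₂
  have hB := hypB_of_not_isOfGroupLikeType C₁.opsData C₂.opsData h.Ψ C₁.opsData_not_isOfGroupLikeType
  have hB' := hypB_of_not_isOfGroupLikeType C₂.opsData C₁.opsData h.Ψ.symm C₂.opsData_not_isOfGroupLikeType
  -- [FrdI] Thm. 3.4 (ii) (named fact, 2008 wording) and (iii) (its tree consequence) for `Ψ`, `Ψ⁻¹`
  have h2 : C₁.opsData.Thm34ii C₂.opsData h.Ψ := h34 _ _ hF₁ hF₂ h.Ψ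
  have h2' : C₂.opsData.Thm34ii C₁.opsData h.Ψ.symm := h34 _ _ hF₂ hF₁ h.Ψ.symm
  have h3 : C₁.opsData.Thm34iii C₂.opsData h.Ψ := FrdI.thm34iii_ofFunctor_of_thm34ii hF₁ hF₂ h.Ψ h2 h2'
  have h3' : C₂.opsData.Thm34iii C₁.opsData h.Ψ.symm :=
    FrdI.thm34iii_ofFunctor_of_thm34ii hF₂ hF₁ h.Ψ.symm h2' h2
  -- rows C38-L02a, L07
  have hps : h.PreservesPreSteps :=
    h.preservesPreSteps_of_thm34ii h2 h2' (C₁.opsData_isOfQuasiIsotropicType hF₁)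
      (C₂.opsData_isOfQuasiIsotropicType hF₂)
  have h7 : h.PreservesFactorisation := h.preservesFactorisation_of_thm34 hps h3 h3' H hB hB'
  -- C38-L08 assembly over C38-L06 (criteria as binders), L07b, L07c
  exact h.cor38_i_of_rows
    (fun hFs hFs' => h.preservesBsFldPreSteps_of_thm34ii_of_criteria h34 hF₁ hF₂ hstd₁ hstd₂ hc₁ hc₂ hFs hFs')
    h7 (C₁.hasFactorisations_of_isFrobenioid hF₁) (C₁.bsFldOfFactorisation_of_isFrobenioid hF₁)
    (C₂.bsFldOfFactorisation_of_isFrobenioid hF₂)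

end AnyVocab

namespace Cor38Hyp

/-! ## §2 The WEAK canonical monoid vocabulary, arbitrary category vocabularies -/

section Weak

variable {D₀ : Type u₀} [Category.{v₀} D₀] {D₀' : Type u₀} [Category.{v₀} D₀']
  {T : RealifiedDivisorMonoids (D₀ := D₀) treeMonoidVocabWeak.{w}}
  {T' : RealifiedDivisorMonoids (D₀ := D₀') treeMonoidVocabWeak.{w}}
  {D : Type u} [Category.{v} D] {D' : Type u} [Category.{v} D']
  {VD : FrdICatStub.{u, v, w} D} {VD' : FrdICatStub.{u, v, w} D'}
  {C₁ : TemperedFrobenioid T D VD} {C₂ : TemperedFrobenioid T' D' VD'} (h : Cor38Hyp C₁ C₂)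

/-- **[EtTh] Cor. 3.8 (i) AS TYPED over the WEAK canonical monoid vocabulary, the criteria C38-L05 as binders**:
inputs `hF_i` ([FrdI] Thm. 5.2 (ii)) and `hc_i` ONLY — row C38-L01 is abc-iut-L2-d2's unconditional
`standardIsotropicNotGroupLike_treeMonoidVocabWeak` (so `hstd_i` drop out) and [FrdI] Thm. 3.4 (ii) is
`FrdI.Thm34ii_holds`. [cite: MochizukiEtTh2009, Cor 3.8 p.80] -/
theorem cor38_i_weak_of_criteria
    (hF₁ : PreFrobenioid.IsFrobenioid C₁.toElem) (hF₂ : PreFrobenioid.IsFrobenioid C₂.toElem)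
    (hc₁ : C₁.BsFldPreStepLimitCriterion (PreFrobenioidData.perfection hF₁))
    (hc₂ : C₂.BsFldPreStepLimitCriterion (PreFrobenioidData.perfection hF₂)) :
    Literature.AnabelianGeometry.EtaleTheta.Cor38_i
      (fun E _ => Literature.AlgebraicGeometry.Frobenioids.IsFrobeniusSlim E) h :=
  h.cor38_i_of_thm34ii_of_criteria FrdI.Thm34ii_holds hF₁ hF₂
    h.standardIsotropicNotGroupLike_treeMonoidVocabWeak.standard.1
    h.standardIsotropicNotGroupLike_treeMonoidVocabWeak.standard.2 hc₁ hc₂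

/-- **[EtTh] Cor. 3.8 (i) AS TYPED over the WEAK canonical monoid vocabulary** (tempered coverings with infinitely
many special-fibre components, F-L2d2-1), ANY category vocabularies: for tempered Frobenioids `C₁`, `C₂` whose
model categories are Frobenioids (`hF_i`), under `h : Cor38Hyp C₁ C₂` and GIVEN per side the print-level clauses
`hP34Λ_i` (Prop. 3.4 (ii) at monoid type `Λ`), `hNZ_i` (Def. 3.6 (ii)(b): a non-zero effective divisor of
constants) and `hQ_i` (every localized perfection `Φ_i(W)^pf_𝔮` is `ℚ`-monoprime — [FrdI] §0, Rmk. 3.3.1): if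
`D₁`, `D₂` are Frobenius-slim then `Ψ` preserves the base-field-theoretic morphisms.  The criteria are
abc-iut-w4-d084's `bsFldPreStepLimitCriterion_of_coordWeak` (the coordinatewise reading of the LUB in
`(C^pf)^coa-pre_B`, [FrdI] Def. 1.3 (iii)(d) / Def. 2.4 (i), over abc-iut-L2-d2's `IsPerfFactorialWeak` coordinates).
[cite: MochizukiEtTh2009, Cor 3.8 p.80] -/
theorem cor38_i_weak_of_coord
    (hF₁ : PreFrobenioid.IsFrobenioid C₁.toElem) (hF₂ : PreFrobenioid.IsFrobenioid C₂.toElem)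
    (hP34Λ₁ : ∀ (Y : D₀ᵒᵖ) (b : T.BΛ.obj Y) (r : T.ΦR.obj Y),
      T.divΛ Y b = Algebra.GrothendieckGroup.of r → b ∈ T.FΛ Y)
    (hNZ₁ : ∀ A : Dᵒᵖ, ∃ u : (T.BΛ.obj (C₁.baseOp A) : Type w) × Algebra.GrothendieckGroup (C₁.Φ.carrier A),
      u ∈ C₁.cnstFn A ∧ ∃ Z : C₁.Φ.carrier A, Z ≠ 1 ∧ u.2 = Algebra.GrothendieckGroup.of Z)
    (hQ₁ : ∀ (W : D) (𝔮 : Primes (Perfection (C₁.divisorMonoid.obj (op W)))),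
      IsQMonoprime (PfAt (C₁.divisorMonoid.obj (op W)) 𝔮))
    (hP34Λ₂ : ∀ (Y : D₀'ᵒᵖ) (b : T'.BΛ.obj Y) (r : T'.ΦR.obj Y),
      T'.divΛ Y b = Algebra.GrothendieckGroup.of r → b ∈ T'.FΛ Y)
    (hNZ₂ : ∀ A : D'ᵒᵖ, ∃ u : (T'.BΛ.obj (C₂.baseOp A) : Type w) × Algebra.GrothendieckGroup (C₂.Φ.carrier A),
      u ∈ C₂.cnstFn A ∧ ∃ Z : C₂.Φ.carrier A, Z ≠ 1 ∧ u.2 = Algebra.GrothendieckGroup.of Z)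
    (hQ₂ : ∀ (W : D') (𝔮 : Primes (Perfection (C₂.divisorMonoid.obj (op W)))),
      IsQMonoprime (PfAt (C₂.divisorMonoid.obj (op W)) 𝔮)) :
    Literature.AnabelianGeometry.EtaleTheta.Cor38_i
      (fun E _ => Literature.AlgebraicGeometry.Frobenioids.IsFrobeniusSlim E) h :=
  h.cor38_i_weak_of_criteria hF₁ hF₂ (C₁.bsFldPreStepLimitCriterion_of_coordWeak hF₁ hP34Λ₁ hNZ₁ hQ₁)
    (C₂.bsFldPreStepLimitCriterion_of_coordWeak hF₂ hP34Λ₂ hNZ₂ hQ₂)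

/-- **[EtTh] Cor. 3.8 (i) AS TYPED over the WEAK canonical monoid vocabulary with `hP34Λ_i` read from the typed
Prop. 3.4 (ii) structure** `RealifiedDivisorMonoids.Prop34Cnst` (field `mem_FΛ_of_divΛ_eq_of`).  Inputs per side:
`hF_i`, `hP_i : T_i.Prop34Cnst cnst_i`, `hNZ_i`, `hQ_i`. [cite: MochizukiEtTh2009, Cor 3.8 p.80] -/
theorem cor38_i_weak_of_coord_of_prop34Cnst
    {Dcnst : Type u₁} [Category.{v₁} Dcnst] {cnst : D₀ ⥤ Dcnst}
    {Dcnst' : Type u₁} [Category.{v₁} Dcnst'] {cnst' : D₀' ⥤ Dcnst'}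
    (hF₁ : PreFrobenioid.IsFrobenioid C₁.toElem) (hF₂ : PreFrobenioid.IsFrobenioid C₂.toElem)
    (hP₁ : T.Prop34Cnst cnst)
    (hNZ₁ : ∀ A : Dᵒᵖ, ∃ u : (T.BΛ.obj (C₁.baseOp A) : Type w) × Algebra.GrothendieckGroup (C₁.Φ.carrier A),
      u ∈ C₁.cnstFn A ∧ ∃ Z : C₁.Φ.carrier A, Z ≠ 1 ∧ u.2 = Algebra.GrothendieckGroup.of Z)
    (hQ₁ : ∀ (W : D) (𝔮 : Primes (Perfection (C₁.divisorMonoid.obj (op W)))),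
      IsQMonoprime (PfAt (C₁.divisorMonoid.obj (op W)) 𝔮))
    (hP₂ : T'.Prop34Cnst cnst')
    (hNZ₂ : ∀ A : D'ᵒᵖ, ∃ u : (T'.BΛ.obj (C₂.baseOp A) : Type w) × Algebra.GrothendieckGroup (C₂.Φ.carrier A),
      u ∈ C₂.cnstFn A ∧ ∃ Z : C₂.Φ.carrier A, Z ≠ 1 ∧ u.2 = Algebra.GrothendieckGroup.of Z)
    (hQ₂ : ∀ (W : D') (𝔮 : Primes (Perfection (C₂.divisorMonoid.obj (op W)))),
      IsQMonoprime (PfAt (C₂.divisorMonoid.obj (op W)) 𝔮)) :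
    Literature.AnabelianGeometry.EtaleTheta.Cor38_i
      (fun E _ => Literature.AlgebraicGeometry.Frobenioids.IsFrobeniusSlim E) h :=
  h.cor38_i_weak_of_coord hF₁ hF₂ hP₁.mem_FΛ_of_divΛ_eq_of hNZ₁ hQ₁ hP₂.mem_FΛ_of_divΛ_eq_of hNZ₂ hQ₂

end Weak

/-! ## §3 The WEAK monoid vocabulary at the canonical category vocabulary `treeCatVocab` -/

section WeakCanonical

variable {D₀ : Type u₀} [Category.{v₀} D₀] {D₀' : Type u₀} [Category.{v₀} D₀']
  {T : RealifiedDivisorMonoids (D₀ := D₀) treeMonoidVocabWeak.{w}}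
  {T' : RealifiedDivisorMonoids (D₀ := D₀') treeMonoidVocabWeak.{w}}
  {D : Type u} [Category.{v} D] {D' : Type u} [Category.{v} D']
  {IsRational IsStrictlyRational : (Dᵒᵖ ⥤ CommMonCat.{w}) → Prop}
  {IsRational' IsStrictlyRational' : (D'ᵒᵖ ⥤ CommMonCat.{w}) → Prop}
  {C₁ : TemperedFrobenioid T D (treeCatVocab D IsRational IsStrictlyRational)}
  {C₂ : TemperedFrobenioid T' D' (treeCatVocab D' IsRational' IsStrictlyRational')} (h : Cor38Hyp C₁ C₂)

/-- **[EtTh] Cor. 3.8 (i) AS TYPED over the WEAK monoid vocabulary at the canonical category vocabulary**: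
`hF_i` ⟸ abc-iut-L2's standing residual `hBmon_i` ("`𝔹_i` is a monoid on `D_i`", [FrdI] Thm. 5.2 (ii),
`isFrobenioid_treeCatVocab_of_isMonoidOn`).  Inputs per side: `hBmon_i`, `hP34Λ_i`, `hNZ_i`, `hQ_i`.
[cite: MochizukiEtTh2009, Cor 3.8 p.80] -/
theorem cor38_i_weak_canonical_of_coord
    (hBmon₁ : IsMonoidOn C₁.ratFnFunctor) (hBmon₂ : IsMonoidOn C₂.ratFnFunctor)
    (hP34Λ₁ : ∀ (Y : D₀ᵒᵖ) (b : T.BΛ.obj Y) (r : T.ΦR.obj Y),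
      T.divΛ Y b = Algebra.GrothendieckGroup.of r → b ∈ T.FΛ Y)
    (hNZ₁ : ∀ A : Dᵒᵖ, ∃ u : (T.BΛ.obj (C₁.baseOp A) : Type w) × Algebra.GrothendieckGroup (C₁.Φ.carrier A),
      u ∈ C₁.cnstFn A ∧ ∃ Z : C₁.Φ.carrier A, Z ≠ 1 ∧ u.2 = Algebra.GrothendieckGroup.of Z)
    (hQ₁ : ∀ (W : D) (𝔮 : Primes (Perfection (C₁.divisorMonoid.obj (op W)))),
      IsQMonoprime (PfAt (C₁.divisorMonoid.obj (op W)) 𝔮))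
    (hP34Λ₂ : ∀ (Y : D₀'ᵒᵖ) (b : T'.BΛ.obj Y) (r : T'.ΦR.obj Y),
      T'.divΛ Y b = Algebra.GrothendieckGroup.of r → b ∈ T'.FΛ Y)
    (hNZ₂ : ∀ A : D'ᵒᵖ, ∃ u : (T'.BΛ.obj (C₂.baseOp A) : Type w) × Algebra.GrothendieckGroup (C₂.Φ.carrier A),
      u ∈ C₂.cnstFn A ∧ ∃ Z : C₂.Φ.carrier A, Z ≠ 1 ∧ u.2 = Algebra.GrothendieckGroup.of Z)
    (hQ₂ : ∀ (W : D') (𝔮 : Primes (Perfection (C₂.divisorMonoid.obj (op W)))),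
      IsQMonoprime (PfAt (C₂.divisorMonoid.obj (op W)) 𝔮)) :
    Literature.AnabelianGeometry.EtaleTheta.Cor38_i
      (fun E _ => Literature.AlgebraicGeometry.Frobenioids.IsFrobeniusSlim E) h :=
  h.cor38_i_weak_of_coord (C₁.isFrobenioid_treeCatVocab_of_isMonoidOn hBmon₁)
    (C₂.isFrobenioid_treeCatVocab_of_isMonoidOn hBmon₂) hP34Λ₁ hNZ₁ hQ₁ hP34Λ₂ hNZ₂ hQ₂

/-- **[EtTh] Cor. 3.8 (i) AS TYPED over the WEAK monoid vocabulary at the canonical category vocabulary from NAMED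
PRINT-LEVEL CLAUSES ONLY**: `hBmon_i` ⟸ (`hBinj_i`, `hFSM_i`) through abc-iut-L2-t3's `isFrobenioid_of_structural`
(pull-backs of `B₀^Λ` injective; FSM-morphisms of `D_i` are isomorphisms), `hP34Λ_i` ⟸ the typed structure
`T_i.Prop34Cnst cnst_i`.  Inputs per side: `hBinj_i`, `hFSM_i`, `hP_i`, `hNZ_i`, `hQ_i`.
[cite: MochizukiEtTh2009, Cor 3.8 p.80] -/
theorem cor38_i_weak_canonical_of_structural
    {Dcnst : Type u₁} [Category.{v₁} Dcnst] {cnst : D₀ ⥤ Dcnst}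
    {Dcnst' : Type u₁} [Category.{v₁} Dcnst'] {cnst' : D₀' ⥤ Dcnst'}
    (hBinj₁ : ∀ {Y Y' : D₀ᵒᵖ} (g : Y ⟶ Y'), Injective (T.BΛ.map g).hom)
    (hFSM₁ : ∀ {A B : D} (α : B ⟶ A), IsFSM α → IsIso α)
    (hP₁ : T.Prop34Cnst cnst)
    (hNZ₁ : ∀ A : Dᵒᵖ, ∃ u : (T.BΛ.obj (C₁.baseOp A) : Type w) × Algebra.GrothendieckGroup (C₁.Φ.carrier A),
      u ∈ C₁.cnstFn A ∧ ∃ Z : C₁.Φ.carrier A, Z ≠ 1 ∧ u.2 = Algebra.GrothendieckGroup.of Z)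
    (hQ₁ : ∀ (W : D) (𝔮 : Primes (Perfection (C₁.divisorMonoid.obj (op W)))),
      IsQMonoprime (PfAt (C₁.divisorMonoid.obj (op W)) 𝔮))
    (hBinj₂ : ∀ {Y Y' : D₀'ᵒᵖ} (g : Y ⟶ Y'), Injective (T'.BΛ.map g).hom)
    (hFSM₂ : ∀ {A B : D'} (α : B ⟶ A), IsFSM α → IsIso α)
    (hP₂ : T'.Prop34Cnst cnst')
    (hNZ₂ : ∀ A : D'ᵒᵖ, ∃ u : (T'.BΛ.obj (C₂.baseOp A) : Type w) × Algebra.GrothendieckGroup (C₂.Φ.carrier A),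
      u ∈ C₂.cnstFn A ∧ ∃ Z : C₂.Φ.carrier A, Z ≠ 1 ∧ u.2 = Algebra.GrothendieckGroup.of Z)
    (hQ₂ : ∀ (W : D') (𝔮 : Primes (Perfection (C₂.divisorMonoid.obj (op W)))),
      IsQMonoprime (PfAt (C₂.divisorMonoid.obj (op W)) 𝔮)) :
    Literature.AnabelianGeometry.EtaleTheta.Cor38_i
      (fun E _ => Literature.AlgebraicGeometry.Frobenioids.IsFrobeniusSlim E) h :=
  h.cor38_i_weak_of_coord (C₁.isFrobenioid_of_structural hBinj₁ hFSM₁)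
    (C₂.isFrobenioid_of_structural hBinj₂ hFSM₂) hP₁.mem_FΛ_of_divΛ_eq_of hNZ₁ hQ₁
    hP₂.mem_FΛ_of_divΛ_eq_of hNZ₂ hQ₂

end WeakCanonical

end Cor38Hyp

end Literature.AnabelianGeometry.EtaleTheta
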